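import Literature.Analysis.FluidPDE.HardSphereFlowOrbits
import Summits.AtomisticToContinuum.HydrodynamicLimit.Theorems.LambertianContactSwapCollisionMomentBoundBridge
import HarnessLib

/-!
# Pathwise velocity telescoping along Alexander's collision-by-collision construction

Crux `Summit.AtomisticToContinuum.HydrodynamicLimit.Theses.LambertianContactSwap.ContactAngleEquidistribution`
(stmt-AtomisticToContinuum-12097), line `Sketch` v8, stub `stub_velTelescope` (the pathwise half of the
"collision sum rule" `stub_sumRule`). In Alexander's construction of the hard-sphere flow
(`Literature.Analysis.FluidPDE.HardSphereFlowConstruction`: `z_{m+1} = collisionStep z_m`,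
`z_m = Alexander.stateAfter z m`) velocities change only at collisions: the `m`-th free flight keeps them
(`freeFlight_apply`), and on a forward-good datum with finite `m`-th free exit time the next state is the
elastic collision `collidePair p.1 p.2 y_m` of the unique incoming contact pair `p` of the pre-collisional exit
configuration `y_m = S_{τ(z_m)} z_m` (`Alexander.FwdGood.exists_stateAfter_succ`), which changes only the two
velocities of `p` (`collidePair_apply_of_ne`). Hence for every velocity observable `φ` with values in an
additive commutative group the sum over the first `K` collisions of the `hit`-selected collisional changes
`φ(vᵢ') + φ(vⱼ') − φ(vᵢ) − φ(vⱼ)` (selector `i < j ∧ y ∈ contactSet i j ∧ IsIncoming y i j`, which on `y_m`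
picks exactly the pair `p`, `LambertianContactSwapCollisionMomentBound.sum_sum_ite_hit_eq`) telescopes to
`Σᵢ φ(vᵢ(z_K)) − Σᵢ φ(vᵢ(z_0))`:

* `sum_collidePair_sub_sum` — one collision: `Σₖ φ((collidePair i j y k).2) − Σₖ φ((y k).2)` is the change
  of the pair `(i, j)`, `i ≠ j`;
* `stub_velTelescope` — the telescoping identity (induction on `K`).

References: folklore (C. Cercignani, R. Illner, M. Pulvirenti, *The Mathematical Theory of Dilute Gases*
(1994), §4.2 and App. 4.A).
-/

noncomputable section

open Set Function
open scoped ENNReal BigOperators Classical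

namespace Summit.AtomisticToContinuum.HydrodynamicLimit.Theorems.ContactAngleEquidistributionSketch

open Literature.Analysis.FluidPDE
open Summit.AtomisticToContinuum.HydrodynamicLimit.Theorems.LambertianContactSwapCollisionMomentBound

variable {d : Type*} [Fintype d] {X : Type*} {n : ℕ}

/-- One binary elastic collision changes `Σₖ φ(vₖ)` only through the colliding pair: for `i ≠ j`,
`Σₖ φ((collidePair i j y k).2) − Σₖ φ((y k).2) = φ(vᵢ') + φ(vⱼ') − φ(vᵢ) − φ(vⱼ)`
(`collidePair_apply_of_ne`: the other particles are untouched). [folklore] -/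
theorem sum_collidePair_sub_sum (G : Geometry d X) {M : Type*} [AddCommGroup M]
    (φ : EuclideanSpace ℝ d → M) {i j : Fin n} (hij : i ≠ j) (y : Config n d X) :
    ∑ k, φ ((collidePair G i j y k).2) - ∑ k, φ ((y k).2) =
      φ ((collidePair G i j y i).2) + φ ((collidePair G i j y j).2) - φ ((y i).2) - φ ((y j).2) := by
  rw [← Finset.sum_sub_distrib, Fintype.sum_eq_add i j hij]
  · abel
  · intro k hk
    rw [collidePair_apply_of_ne hk.1 hk.2, sub_self]

/-- **Pathwise velocity telescoping along Alexander's construction.** On a forward-good datum `z` whose first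
`K` free flights are finite, the change of `Σᵢ φ(vᵢ)` over the first `K` collisions is the sum over `m < K` of
the `hit`-selected collisional changes read on the pre-collisional exit configurations
`y_m = S_{τ(z_m)} z_m`: by `Alexander.FwdGood.exists_stateAfter_succ`, `z_{m+1} = collidePair p.1 p.2 y_m` for
the unique incoming contact pair `p` of `y_m`, the selector picks exactly `p` (`sum_sum_ite_hit_eq`), free
flight keeps the velocities and `collidePair` changes only those of the pair (`sum_collidePair_sub_sum`).
[folklore] -/
theorem stub_velTelescope {d : Type*} [Fintype d] {X : Type*} {n : ℕ} (G : Geometry d X) (ε : ℝ)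
    {M : Type*} [AddCommGroup M] (φ : EuclideanSpace ℝ d → M) {z : Config n d X}
    (hz : Alexander.FwdGood G ε z) {K : ℕ}
    (hK : ∀ m < K, Alexander.freeExitTime G ε (Alexander.stateAfter G ε z m) ≠ ∞) :
    ∑ i, φ ((Alexander.stateAfter G ε z K i).2) - ∑ i, φ ((z i).2) =
      ∑ m ∈ Finset.range K, ∑ i : Fin n, ∑ j : Fin n,
        (let y := freeFlight G (Alexander.freeExitTime G ε (Alexander.stateAfter G ε z m)).toReal
            (Alexander.stateAfter G ε z m)
         if i < j ∧ y ∈ contactSet G n ε i j ∧ IsIncoming G y i j then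
           φ ((collidePair G i j y i).2) + φ ((collidePair G i j y j).2) - φ ((y i).2) - φ ((y j).2)
         else 0) := by
  dsimp only
  induction K with
  | zero => simp
  | succ K ih =>
    rw [Finset.sum_range_succ, ← ih fun m hm => hK m (Nat.lt_succ_of_lt hm)]
    obtain ⟨p, hp, heq⟩ := hz.exists_stateAfter_succ (hK K K.lt_succ_self)
    set y : Config n d X :=
      freeFlight G (Alexander.freeExitTime G ε (Alexander.stateAfter G ε z K)).toReal
        (Alexander.stateAfter G ε z K) with hy
    have hsum : (∑ i : Fin n, ∑ j : Fin n,
        (if i < j ∧ y ∈ contactSet G n ε i j ∧ IsIncoming G y i j then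
          φ ((collidePair G i j y i).2) + φ ((collidePair G i j y j).2) - φ ((y i).2) - φ ((y j).2)
         else 0)) =
        φ ((collidePair G p.1 p.2 y p.1).2) + φ ((collidePair G p.1 p.2 y p.2).2) - φ ((y p.1).2) -
          φ ((y p.2).2) :=
      sum_sum_ite_hit_eq hp fun y i j =>
        φ ((collidePair G i j y i).2) + φ ((collidePair G i j y j).2) - φ ((y i).2) - φ ((y j).2)
    have hvel : ∑ i, φ ((y i).2) = ∑ i, φ ((Alexander.stateAfter G ε z K i).2) := rfl
    rw [hsum, heq, ← sum_collidePair_sub_sum G φ hp.ne y, hvel]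
    abel

end Summit.AtomisticToContinuum.HydrodynamicLimit.Theorems.ContactAngleEquidistributionSketch
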